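import Literature.NumberTheory.Weil1964.ArchGaussianOrbit
import Literature.Analysis.SegalBargmann.SchwartzFourierUnitary
import HarnessLib

/-!
# The Fourier transform of `e^{πi xτx}` and the overlap `⟪h₀, e^{πi xτx}⟫` — branch-free (Folland §4.5 Thm. (4.65), App. A Thm. 1)

Topic `NumberTheory/Weil1964`; namespace `Literature.NumberTheory.Weil1964`.  KERNEL throughout: proved theorems only —
no records, no `sorry`, no cited hypothesis.

File 3 of the Schrödinger-model «Gaussian-orbit» proof of Folland's Thm. (4.37) (records R1/R2 of
`ArchMetaplecticDoubleCover`; row B07-3 of the pub-hodgecm2 literature fan-out).  The one analytic input of the whole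
argument is the `n`-dimensional complex Gaussian integral with a linear term,

  `∫_{ℝⁿ} e^{πi ᵗxτx + ᵗw x} dx = K(τ) · e^{(i/4π) ᵗw τ⁻¹ w}`,  `K(τ)² · det(−iτ) = 1`   (`τ ∈ 𝔥ₙ`, `w ∈ ℂⁿ`),

[Folland App. A Thm. 1: `∫ e^{−π xAx − 2πi zx} dx = det^{-1/2}(A) e^{−π zA⁻¹z}` for `A = ᵗA`, `Re A > 0`, `z ∈ ℂⁿ` — here
`A = −iτ`, `z = (i/2π) w`] proved here BRANCH-FREE (the constant `K(τ) = det(−iτ)^{-1/2}` is produced, its square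
identified) by the textbook route: congruence-diagonalise `(Im τ, Re τ)` by a real `T` (tree
`exists_transpose_mul_mul_eq_one_and_eq_diagonal`), substitute `x = Ty` (tree `integral_comp_mulVec_real`), and
multiply `n` one-dimensional complex Gaussian integrals (Mathlib `GaussianFourier.integral_cexp_neg_sum_mul_add`).
Consequences:

* `fourierPi_gaussS` — **the Fourier transform of a Gaussian is a Gaussian at the inverted parameter**:
  `𝓕 (gaussS τ) = m · gaussS (−τ⁻¹)` with `m² · det(−iτ) = 1` [Folland Thm. (4.65), proof, case `𝒜 = 𝒥`:
  `𝓕⁻¹γ_Z = det^{-1/2}(−iZ) γ_{−Z⁻¹}`; the tree's `fourierPi` = Mathlib's `𝓕` = `μ(i·1)|_𝓢` by `fourierPi_eq_unitaryOpPi`,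
  and `𝓕 γ_Z = 𝓕⁻¹ γ_Z` since `γ_Z` is even];
* `inner_toL2_hermitePi_zero_gaussS_sq` — **the vacuum overlap** `⟪h₀, gaussS τ⟫² · det(1 − iτ) = 2^{n/2}`
  [Folland (4.36): `⟨ν(𝒜)E₀, E₀⟩ = det^{-1/2}(…)`, Schrödinger-model form].

## References

* [Folland1989] G. B. Folland, *Harmonic Analysis in Phase Space*, Princeton UP 1989 (held text
  `book:folland1989-harmonic-analysis-phase-space`): §4.5 «Gaussians and the symmetric space» — `Σₙ`, (4.60), the action
  `α`, the multiplier (4.61), the cocycle (4.62)–(4.63), Thm. (4.64), `γ_Z(x) = e^{πi xZx}`, Thm. (4.65)/(4.66)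
  (chunks p0176–p0178); Appendix A Thm. 1 (chunk p0225); §4.2 (4.36).
* L. Hörmander, *The Analysis of Linear Partial Differential Operators I*, Thm. 7.6.1 (the same Gaussian integral).
-/

set_option autoImplicit false

noncomputable section

open Complex Matrix MeasureTheory SchwartzMap
open scoped ComplexOrder ComplexConjugate Real InnerProductSpace FourierTransform

namespace Literature.NumberTheory.Weil1964

open Literature.Analysis.SegalBargmann Literature.RepresentationTheory.HeisenbergGroup
  Literature.Analysis.SpecialFunctions

variable {σ : Type*} [Fintype σ] [DecidableEq σ]

/-! ## 1. The complex Gaussian integral with a linear term, branch-free -/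

/-- **`∫_{ℝⁿ} e^{πi ᵗxτx + ᵗwx} dx = K(τ) e^{(i/4π) ᵗwτ⁻¹w}` with `K(τ)² · det(−iτ) = 1`**, for `τ ∈ 𝔥_σ` and every
complex `w` (classically `K(τ) = det(τ/i)^{-1/2}` with the branch fixed by continuation from `τ = iY`; here the
constant is produced by diagonalisation and only its square is identified). [cite: Folland1989, App. A Thm. 1] -/
theorem exists_integral_gaussFun_mul_cexp {τ : Matrix σ σ ℂ} (hτ : τ ∈ siegelH σ) :
    ∃ K : ℂ, K ^ 2 * (-I • τ).det = 1 ∧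
      ∀ w : σ → ℂ, ∫ x : σ → ℝ, gaussFun τ x * cexp (w ⬝ᵥ cvec x) =
        K * cexp ((I / (4 * π)) * (w ⬝ᵥ (τ⁻¹ *ᵥ w))) := by
  have hX : (τ.map Complex.re).IsSymm := hτ.1.map _
  obtain ⟨T, hTdet, hTY, d, hTX⟩ := exists_transpose_mul_mul_eq_one_and_eq_diagonal hτ.2 hX
  -- the one-dimensional parameters `b_i = π(1 − i d_i) = −πi(d_i + i)`
  set b : σ → ℂ := fun i => (π : ℂ) * (1 - I * (d i : ℂ)) with hb
  have hdI : ∀ i, (d i : ℂ) + I ≠ 0 := fun i h => by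
    have := congrArg Complex.im h
    simp at this
  have hb' : ∀ i, b i = (π : ℂ) * (-I * ((d i : ℂ) + I)) := fun i => by
    simp only [hb]; ring_nf; rw [I_sq]; ring
  have hbre : ∀ i, 0 < (b i).re := fun i => by simp [hb, Real.pi_pos]
  have hbne : ∀ i, b i ≠ 0 := fun i h => by simpa [h] using hbre i
  have hπ : (π : ℂ) ≠ 0 := Complex.ofReal_ne_zero.2 Real.pi_ne_zero
  have hbinv : ∀ i, (b i)⁻¹ = I / π * ((d i : ℂ) + I)⁻¹ := fun i => by
    rw [hb' i, mul_inv, mul_inv, inv_neg, Complex.inv_I, neg_neg, div_eq_mul_inv]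
    ring
  -- complexified congruence diagonalisation `ᵗP τ P = diag(d_i + i)`, `P = T`
  set P : Matrix σ σ ℂ := Complex.ofRealHom.mapMatrix T with hP
  have hPt : Pᵀ = Complex.ofRealHom.mapMatrix Tᵀ := rfl
  have hPY : Pᵀ * Complex.ofRealHom.mapMatrix (τ.map Complex.im) * P = 1 := by
    rw [hPt, hP, ← map_mul, ← map_mul, hTY, map_one]
  have hPX : Pᵀ * Complex.ofRealHom.mapMatrix (τ.map Complex.re) * P = Complex.ofRealHom.mapMatrix (diagonal d) := by
    rw [hPt, hP, ← map_mul, ← map_mul, hTX]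
  have hD : Pᵀ * τ * P = diagonal (fun i => (d i : ℂ) + I) := by
    conv_lhs => rw [← RC_re_add_I_smul_RC_im τ]
    rw [Matrix.mul_add, Matrix.add_mul, Matrix.mul_smul, Matrix.smul_mul, hPY, hPX]
    ext i j
    by_cases hij : i = j
    · subst hij; simp [RingHom.mapMatrix_apply]
    · simp [RingHom.mapMatrix_apply, hij]
  have hdetP : P.det = ((T.det : ℝ) : ℂ) := by rw [hP, ← RingHom.map_det]; rfl
  have hdetT0 : ((T.det : ℝ) : ℂ) ≠ 0 := by exact_mod_cast hTdet
  have hPunit : IsUnit P.det := by rw [hdetP]; exact hdetT0.isUnit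
  have hdetτ : ((T.det : ℝ) : ℂ) ^ 2 * τ.det = ∏ i, ((d i : ℂ) + I) := by
    have h := congrArg Matrix.det hD
    rw [Matrix.det_mul, Matrix.det_mul, Matrix.det_transpose, hdetP, Matrix.det_diagonal] at h
    rw [← h]; ring
  -- `τ⁻¹ = P diag((d_i+i)⁻¹) ᵗP`
  have hDD : diagonal (fun i => ((d i : ℂ) + I)⁻¹) * diagonal (fun i => (d i : ℂ) + I) = 1 := by
    rw [Matrix.diagonal_mul_diagonal, ← Matrix.diagonal_one]
    exact congrArg Matrix.diagonal (funext fun i => inv_mul_cancel₀ (hdI i))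
  have hτinv : τ⁻¹ = P * diagonal (fun i => ((d i : ℂ) + I)⁻¹) * Pᵀ := by
    apply Matrix.inv_eq_left_inv
    have h1 : Pᵀ * τ = diagonal (fun i => (d i : ℂ) + I) * P⁻¹ := by
      rw [← hD, Matrix.mul_assoc (Pᵀ * τ) P P⁻¹, Matrix.mul_nonsing_inv _ hPunit, Matrix.mul_one]
    calc P * diagonal (fun i => ((d i : ℂ) + I)⁻¹) * Pᵀ * τ
        = P * diagonal (fun i => ((d i : ℂ) + I)⁻¹) * (Pᵀ * τ) := by rw [Matrix.mul_assoc]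
      _ = P * (diagonal (fun i => ((d i : ℂ) + I)⁻¹) * diagonal (fun i => (d i : ℂ) + I)) * P⁻¹ := by
          rw [h1]; simp only [Matrix.mul_assoc]
      _ = 1 := by rw [hDD, Matrix.mul_one, Matrix.mul_nonsing_inv _ hPunit]
  -- the constant
  refine ⟨((|T.det| : ℝ) : ℂ) * ∏ i, ((π : ℂ) / b i) ^ (1 / 2 : ℂ), ?_, fun w => ?_⟩
  · -- `K² det(−iτ) = ∏ (π/b_i)(−i)(d_i + i) = 1`
    have hsq : ∀ i, (((π : ℂ) / b i) ^ (1 / 2 : ℂ)) ^ 2 = (π : ℂ) / b i := fun i => by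
      rw [← Complex.cpow_nat_mul]; norm_num
    have habs2 : ((|T.det| : ℝ) : ℂ) ^ 2 = ((T.det : ℝ) : ℂ) ^ 2 := by
      rw [← Complex.ofReal_pow, ← Complex.ofReal_pow, sq_abs]
    have hfac : ∀ i, (π : ℂ) / b i * (-I) * ((d i : ℂ) + I) = 1 := fun i => by
      calc (π : ℂ) / b i * (-I) * ((d i : ℂ) + I)
          = ((π : ℂ) / π) * (-(I * I)) * ((((d i : ℂ) + I))⁻¹ * ((d i : ℂ) + I)) := by
            rw [div_eq_mul_inv, hbinv]; ring
        _ = 1 := by rw [div_self hπ, I_mul_I, inv_mul_cancel₀ (hdI i)]; norm_num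
    rw [Matrix.det_smul, mul_pow, habs2, ← Finset.prod_pow]
    simp_rw [hsq]
    calc ((T.det : ℝ) : ℂ) ^ 2 * (∏ i, (π : ℂ) / b i) * ((-I) ^ Fintype.card σ * τ.det)
        = (∏ i, (π : ℂ) / b i) * (-I) ^ Fintype.card σ * (((T.det : ℝ) : ℂ) ^ 2 * τ.det) := by ring
      _ = (∏ i, (π : ℂ) / b i) * (∏ _i : σ, (-I)) * ∏ i, ((d i : ℂ) + I) := by
          rw [hdetτ, Finset.prod_const, Finset.card_univ]
      _ = ∏ i, ((π : ℂ) / b i * (-I) * ((d i : ℂ) + I)) := by rw [Finset.prod_mul_distrib, Finset.prod_mul_distrib]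
      _ = 1 := by rw [Finset.prod_congr rfl fun i _ => hfac i, Finset.prod_const_one]
  · -- the integral
    set F : (σ → ℝ) → ℂ := fun x => gaussFun τ x * cexp (w ⬝ᵥ cvec x) with hF
    set c : σ → ℂ := w ᵥ* P with hc
    have hquad : ∀ y : σ → ℝ, cvec (T *ᵥ y) ⬝ᵥ (τ *ᵥ cvec (T *ᵥ y)) = ∑ i, ((d i : ℂ) + I) * ((y i : ℝ) : ℂ) ^ 2 :=
      fun y => by
        rw [cvec_mulVec, dotProduct_mulVec_mulVec_eq_complex, ← hP, hD]
        simp only [dotProduct, Matrix.mulVec_diagonal, cvec_apply, sq]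
        exact Finset.sum_congr rfl fun i _ => by ring
    have hlin : ∀ y : σ → ℝ, w ⬝ᵥ cvec (T *ᵥ y) = ∑ i, c i * ((y i : ℝ) : ℂ) := fun y => by
      rw [cvec_mulVec, ← hP, Matrix.dotProduct_mulVec, ← hc]
      rfl
    have hpull : ∀ y : σ → ℝ, F (T *ᵥ y) = cexp (-∑ i, b i * ((y i : ℝ) : ℂ) ^ 2 + ∑ i, c i * ((y i : ℝ) : ℂ)) :=
      fun y => by
        simp only [hF]
        rw [gaussFun_apply, hquad, hlin, ← Complex.exp_add]
        congr 1
        rw [Finset.mul_sum, ← Finset.sum_neg_distrib]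
        congr 1
        refine Finset.sum_congr rfl fun i _ => ?_
        rw [hb' i]; ring
    -- the pulled-back integral factorises (Mathlib, one variable at a time)
    have hIy : ∫ y : σ → ℝ, F (T *ᵥ y) = ∏ i, ((π : ℂ) / b i) ^ (1 / 2 : ℂ) * cexp (c i ^ 2 / (4 * b i)) := by
      simp_rw [hpull]
      exact GaussianFourier.integral_cexp_neg_sum_mul_add hbre c
    -- change of variables `x = Ty`
    have hI : ∫ x, F x = ((|T.det| : ℝ) : ℂ) * ∏ i, ((π : ℂ) / b i) ^ (1 / 2 : ℂ) * cexp (c i ^ 2 / (4 * b i)) := by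
      have hcv := integral_comp_mulVec_real T hTdet F
      rw [hIy] at hcv
      have habs : |T.det| ≠ 0 := abs_ne_zero.mpr hTdet
      have : ∫ x, F x = |T.det| • (|T.det|⁻¹ • ∫ x, F x) := by
        rw [smul_smul, mul_inv_cancel₀ habs, one_smul]
      rw [this, ← hcv, Complex.real_smul]
    -- the exponent: `Σ c_i²/(4b_i) = (i/4π) ᵗw τ⁻¹ w`
    have hexp : ∑ i, c i ^ 2 / (4 * b i) = I / (4 * π) * (w ⬝ᵥ (τ⁻¹ *ᵥ w)) := by
      rw [hτinv, ← Matrix.mulVec_mulVec, ← Matrix.mulVec_mulVec, Matrix.dotProduct_mulVec w P,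
        Matrix.mulVec_transpose, ← hc]
      simp only [dotProduct, Matrix.mulVec_diagonal]
      rw [Finset.mul_sum]
      refine Finset.sum_congr rfl fun i _ => ?_
      rw [div_eq_mul_inv, mul_inv, hbinv]
      ring
    show ∫ x, F x = _
    rw [hI, Finset.prod_mul_distrib, ← Complex.exp_sum, hexp, mul_assoc]

/-! ## 2. The Fourier transform of a Gaussian -/

omit [DecidableEq σ] in
/-- `⟪toL2 u, toL2 v⟫ = ∫ conj(u) v`. [cite: Folland1989, §1.7] -/
private theorem inner_toL2_eq_integral' (u v : SchwartzMap (σ → ℝ) ℂ) : ⟪toL2 u, toL2 v⟫_ℂ = ∫ x, conj (u x) * v x := by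
  rw [MeasureTheory.L2.inner_def]
  refine integral_congr_ae ?_
  filter_upwards [coeFn_toL2 u, coeFn_toL2 v] with x hu hv
  rw [hu, hv]
  exact RCLike.inner_apply' _ _

omit [DecidableEq σ] in
/-- The phase of Mathlib's Fourier kernel on the Folland carrier: `e^{−2πi ⟪e⁻¹x, e⁻¹ξ⟫} = e^{ᵗw x}` with
`w = −2πi ξ`. [cite: Folland1989, App. A Thm. 1] -/
private theorem fourierKernel_eq (x ξ : σ → ℝ) :
    cexp ((((-2 * π * ⟪(euclE σ).symm x, (euclE σ).symm ξ⟫_ℝ) : ℝ) : ℂ) * I) =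
      cexp ((fun i => -(2 * π * I) * (ξ i : ℂ)) ⬝ᵥ cvec x) := by
  have hin : ⟪(euclE σ).symm x, (euclE σ).symm ξ⟫_ℝ = ξ ⬝ᵥ x := by
    rw [EuclideanSpace.inner_eq_star_dotProduct, star_trivial]
    rfl
  congr 1
  rw [hin]
  simp only [dotProduct, cvec_apply]
  push_cast
  rw [Finset.mul_sum, Finset.sum_mul]
  exact Finset.sum_congr rfl fun i _ => by ring

/-- **The Fourier transform of a Gaussian is the Gaussian at the inverted parameter, branch-free**: for `τ ∈ 𝔥_σ`,
`𝓕 (e^{πi xτx}) = m · e^{−πi ξτ⁻¹ξ}` with `m² · det(−iτ) = 1` (the Weyl element `J : τ ↦ −τ⁻¹` of the Siegel action, with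
squared multiplier `det(−iτ)⁻¹`). [cite: Folland1989, §4.5 Thm. (4.65) (proof, case 𝒥); App. A Thm. 1, Thm. 2] -/
theorem fourierPi_gaussS {τ : Matrix σ σ ℂ} (hτ : τ ∈ siegelH σ) :
    ∃ m : ℂ, m ^ 2 * (-I • τ).det = 1 ∧ fourierPi (gaussS τ) = m • gaussS (-τ⁻¹) := by
  obtain ⟨K, hK, hint⟩ := exists_integral_gaussFun_mul_cexp hτ
  refine ⟨K, hK, ?_⟩
  ext ξ
  rw [fourierPi_apply, schwartzTransport_apply, SchwartzMap.fourier_coe, Real.fourier_eq', _root_.smul_apply,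
    smul_eq_mul, gaussS_apply (neg_inv_mem_siegelH hτ),
    ← measurePreserving_euclE_symm.integral_comp (euclE σ).symm.toHomeomorph.measurableEmbedding]
  have hF : ∀ x : σ → ℝ,
      cexp ((((-2 * π * ⟪(euclE σ).symm x, (euclE σ).symm ξ⟫_ℝ) : ℝ) : ℂ) * I) •
          ((schwartzTransport (euclE σ)).symm (gaussS τ)) ((euclE σ).symm x) =
        gaussFun τ x * cexp ((fun i => -(2 * π * I) * (ξ i : ℂ)) ⬝ᵥ cvec x) := fun x => by
    rw [fourierKernel_eq, schwartzTransport_symm_apply, ContinuousLinearEquiv.apply_symm_apply, gaussS_apply hτ,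
      smul_eq_mul, mul_comm]
  simp_rw [hF]
  rw [hint, gaussFun_apply]
  congr 2
  rw [Matrix.neg_mulVec, dotProduct_neg]
  have hw : (fun i => -(2 * π * I) * (ξ i : ℂ)) = (-(2 * π * I)) • cvec ξ := by
    funext i; rw [Pi.smul_apply, smul_eq_mul, cvec_apply]
  rw [hw, Matrix.mulVec_smul, dotProduct_smul, smul_dotProduct, smul_eq_mul, smul_eq_mul]
  have hπ : (π : ℂ) ≠ 0 := Complex.ofReal_ne_zero.2 Real.pi_ne_zero
  field_simp
  ring_nf
  rw [I_sq]
  ring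

/-! ## 3. The vacuum overlap -/

/-- `h₀(x) = 2^{n/4} e^{−π|x|²}` is real: `conj (h₀ x) = h₀ x`. [cite: Folland1989, §1.7] -/
private theorem conj_hermitePi_zero (x : σ → ℝ) :
    conj (hermitePi (0 : σ →₀ ℕ) x) = hermitePi (0 : σ →₀ ℕ) x := by
  rw [hermitePi_apply, herm_zero, hermiteFun, vac, MvPolynomial.eval_C, gauss]
  have h : (-(π : ℂ) * ∑ k, ((x k : ℝ) : ℂ) ^ 2) = (((-(π * ∑ k, (x k) ^ 2)) : ℝ) : ℂ) := by push_cast; ring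
  rw [h, ← Complex.ofReal_exp, ← Complex.ofReal_mul, Complex.conj_ofReal]

omit [Fintype σ] in
/-- `−i (τ + i1) = 1 − iτ`. [cite: Folland1989, §4.5 (4.62)] -/
private theorem neg_I_smul_add (τ : Matrix σ σ ℂ) : -I • (τ + I • (1 : Matrix σ σ ℂ)) = 1 - I • τ := by
  rw [smul_add, smul_smul, neg_mul, I_mul_I, neg_neg, one_smul, neg_smul]
  abel

/-- **The vacuum overlap, branch-free**: `⟪h₀, gaussS τ⟫² · det(1 − iτ) = 2^{n/2}` for `τ ∈ 𝔥_σ` — i.e.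
`⟪h₀, e^{πi xτx}⟫ = 2^{n/4} det(1 − iτ)^{-1/2}` up to the sign of the root; this is Folland's
`⟨ν(𝒜)E₀, E₀⟩ = K_𝒜(0,0) = det^{-1/2}(P)` read in the Schrödinger model. [cite: Folland1989, §4.2 (4.36); App. A Thm. 1] -/
theorem inner_toL2_hermitePi_zero_gaussS_sq {τ : Matrix σ σ ℂ} (hτ : τ ∈ siegelH σ) :
    ⟪toL2 (hermitePi (0 : σ →₀ ℕ)), toL2 (gaussS τ)⟫_ℂ ^ 2 * (1 - I • τ).det = ((vacCoef σ : ℝ) : ℂ) ^ 2 := by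
  obtain ⟨K, hK, hint⟩ := exists_integral_gaussFun_mul_cexp (add_I_smul_one_mem_siegelH hτ)
  have h0 := hint 0
  have hpt : ∀ x : σ → ℝ, conj (hermitePi (0 : σ →₀ ℕ) x) * gaussS τ x =
      ((vacCoef σ : ℝ) : ℂ) * (gaussFun (τ + I • 1) x * cexp (0 ⬝ᵥ cvec x)) := fun x => by
    rw [conj_hermitePi_zero, zero_dotProduct, Complex.exp_zero, mul_one, hermitePi_zero_eq_smul_gaussS,
      _root_.smul_apply, smul_eq_mul, gaussS_apply I_smul_one_mem_siegelH, gaussS_apply hτ,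
      gaussFun_apply, gaussFun_apply, gaussFun_apply, mul_assoc,
      ← Complex.exp_add, Matrix.add_mulVec, dotProduct_add]
    congr 2
    ring
  rw [inner_toL2_eq_integral']
  simp_rw [hpt]
  rw [integral_const_mul, h0, zero_dotProduct, mul_zero, Complex.exp_zero, mul_one, ← neg_I_smul_add, mul_pow,
    mul_assoc, hK, mul_one]

end Literature.NumberTheory.Weil1964
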